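import Summits.QuantumFields.YangMills.Theorems.BalabanUVNodesPortHRecordJoinG4
import Summits.QuantumFields.YangMills.Theorems.BalabanUVNodesK0RecordFormatNamesLemmas6

/-!
# PORT helper (PT-H ∕ K0ᴬ JOIN lineage `ymgap-nodeO-port-PTC-1`, g3) — JOIN → DOOR, route-independent half: the RADIUS-UNIFORM form of the JOIN's consequent and THE DECAY
# LETTER OF THE K0ᴬ DOORS (`∀ a₀ > 0, ∃ γ₀ ≤ ½, ε₂₉, C, δ₁, RecordPlimDecayOnRunsAx …`) from the two SIGNED port texts (⁸ `Sig8LR4`, ⁷ `Sig7With Tok` ∕ `Sig7V11G4`), the texts' own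
# 12 antecedents + token DISPLAYED as per-family COFINAL witnesses (`JoinAntecedentsCofinal Tok F`), and the (1.21)-Ax letter on runs of level `≤ ½`; the composition with the
# door (K0ᴬ BY NAME) is the companion `…K0RecordDecayRoadFromTexts.lean` (kept apart so that THIS module stays outside the route file's import cone — gate lint `theses-cone`)

WHY THIS FILE.  The frozen JOIN goal (`JoinGoalWith Tok F`, lens-1 §20 ∕ ★★★ director-ym №495 (i)) concludes, at ⁸'s OWN level `γ₀`, `∃ γ₀ ε₂₉ C δ₁, 0 < γ₀ ∧ 0 < ε₂₉ ∧
(RecordPolLimitOnRunsAx F a₀ ε₂₉ γ₀ → RecordPlimDecayOnRunsAx F a₀ ε₂₉ γ₀ C δ₁)`, while the K0ᴬ doors in the tree (✓`K0V23Stub3CofinalRunDoorAx.record13SepCoPHInhabitedAx_of_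
recordPlimDecayOnRunsAx_allRadii` ∕ `…_of_k0PiDecayCofinalRadiiAx`, ✓`K0RecordDecayRoadAx`) want the decay letter at a level `γ₀ ≤ ½`, and the (1.21)-Ax letter of record is a
WINDOW-`½` letter (✓`K0RecordFormatNames.recordPolLimitOnRunsAx_of_polLimitsExist`, `γ₀ ≤ ½`).  ⁸ does not bound its `γ₀` by `½`, so the frozen implication AT `γ₀` cannot be fed
when `γ₀ > ½`.  The JOIN's PROOF, however, is run-by-run (✓`PortHRecordJoin.recordPlimDecayOnRunsAx_at_recordEmbL_of_trace`: (5.10) on each in-window run from the (1.21) limit on THAT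
run), so the SAME constants serve every smaller level: this file re-issues the certificate with the RADIUS-UNIFORM consequent `∀ γ ≤ γ₀, (RecordPolLimitOnRunsAx … γ →
RecordPlimDecayOnRunsAx … γ C δ₁)` (`decayConclR_of_texts`, same letters as `joinGoalWith_of_texts`) and shrinks to `min γ₀ ½` (`decayLetter_of_texts`).  Nothing of the
frozen texts is changed; this is the consumer-side plumbing between `…PortHRecordJoinWith` and the doors of `…K0V23Stub3CofinalRunDoorAx`.

CONTENTS (3 def, the rest theorems; no `sorry` ∕ `instance` ∕ `notation`; standard axioms):
* `inInterval_of_le_radius`, `recordPlimDecayOnRunsAx_of_le_radius`, `recordPolLimitOnRunsAx_of_le_radius` — both run letters are ANTITONE in the level (a run in `]0, γ]` is a run in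
  `]0, γ₀]` for `γ ≤ γ₀`); `alongRuns_of_le_radius` — ◆ CRIT-1's check (A) as a lemma: ⁸'s WHOLE run-indexed package (constants `E₀ κ α₀ α₁` fixed at ⁸'s `γ₀`) restricts to every
  smaller level; only the run-membership guard is level-indexed.
* `JoinGoalWithR Tok F` — the RADIUS-UNIFORM goal (13 hypotheses VERBATIM; consequent uniform in `γ ≤ γ₀`, ONE shared `ε₂₉` — check (B)); `joinGoalWith_of_joinGoalWithR` (`γ := γ₀`);
  ★ `joinGoalWithR_of_texts` — its certificate from the two texts (◆ CRIT-1 04:42:35Z: theorem-side companions of the frozen goal; `JoinGoalL ∕ JoinGoalL11G4` NOT re-pointed).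
* `JoinAntecedents Tok F Mc j c c₀ c₁ B₃ B₃' a₀ a₁` — the CONJUNCTION of ⁸'s twelve antecedents (McGuard, 7 guards, [15] Thm 1 `VariationalThm1RegSepCoP7MGB`, Gauge 9, TokUk, TokP9-reg —
  bytes = the frozen `JoinGoalWith` body's hypotheses VERBATIM, cut mechanically at its 13 top-level arrows) and the token `Tok F Mc a₀`; `JoinAntecedentsCofinal Tok F` — «for every
  threshold `Mth` and every radius `a₀ > 0` the antecedents hold at some `Mc ≥ Mth`» = the SHAPE in which Bałaban's theorems at the record ([I] Thm 1, [15] Thm 1 ∕ Prop. 9, TokUk,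
  Tok-182, Tok-cmpU-cap …) would be supplied.  DISPLAYED hypothesis shapes; nothing asserted; inhabited nowhere.
* ★ `decayConclR_of_texts (Tok) (hBr) (F) (h8 : Sig8LR4 F) (h7 : Sig7With Tok F)` — the RADIUS-UNIFORM JOIN (as `joinGoalWith_of_texts`, antecedents bundled, consequent uniform in `γ ≤ γ₀`).
* ★★ `decayLetter_of_texts … (hA : JoinAntecedentsCofinal Tok F) (h121 : ∀ a₀ ε₂₉ γ, 0 < a₀ → 0 < ε₂₉ → 0 < γ → γ ≤ 1/2 → RecordPolLimitOnRunsAx F a₀ ε₂₉ γ) : ∀ a₀ > 0, ∃ γ₀ ε₂₉ C δ₁,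
  0 < γ₀ ∧ γ₀ ≤ 1/2 ∧ 0 < ε₂₉ ∧ RecordPlimDecayOnRunsAx F a₀ ε₂₉ γ₀ C δ₁` — the decay letter of the doors (lens-1's T′ at `F`; W-UDR-Ax follows by ✓`k0PiDecayCofinalRadiiAx_of_allRadii`).
* §5 (appended, ◇ lens-1 g6 scope flag ∕ O-11): `JoinConclLimR Tok F` (radius-uniform consequent with the (1.21) proviso DISCHARGED in scope), `joinConclLimR_of_decayConclR`,
  ★★ `decayLetter_of_lim (hA : JoinAntecedentsCofinal Tok F) (hL : JoinConclLimR Tok F)` — the door letter WITHOUT `h121`.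
* `run121_of_window121` — the (1.21)-Ax run letter on levels `≤ ½` from its WINDOW-`½` form `PolLimitsExist F (recordTermsAx F a₀ ε₂₉) θ.ρ8 θ.bV (Window (1/2))` (DEF-1 Lemmas6).
  The K0ᴬ-by-name compositions (`record13SepCoPHInhabitedAx_of_texts ∕ _of_textsG4 ∕ _of_textsG4_window`) are in `…K0RecordDecayRoadFromTexts.lean`.
AUTHORSHIP.  Porter PTC-1 g3; the JOIN proof threaded here is ◇ lens-1's (v5.2 §15∕§16, v5.5 §20), the doors are ★ P3 g87's ∕ dag-n07-w3's ∕ dag-n20-d's, the run letters DEF-1's.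
`--supports stmt-QuantumFields-27238 --as helper`; no `--workitem` (R615).  NO route-file import, direct or transitive (docket O-8; gate lint `theses-cone`).

HONEST FRAMING.  CONDITIONAL throughout: every hypothesis is an OPEN signed text (27930 ⁸ 12934e3f; 27931 ⁷-G₄ bca3cb0d), a displayed witness shape for Bałaban's theorems at the
record (NOT proved: [I] Thm 1, [15] Thm 1 ∕ Prop. 9 ∕ (182) ∕ (190), TokUk, the p.290 comparison), or the (1.21)-Ax letter (K3ᴬ ∕ (D4) currency, NOT proved); typed ≠ proved;
K0ᴬ (stmt-QuantumFields-27238) stays OPEN; K-Ax 27239∕27247 OPEN; NODE O 0∕1; COUNT 8∕28 · K 1∕4 UNMOVED; ONE finite `𝕋⁴_{L^K}` at fixed ε — NOT continuum ∕ OS ∕ Clay;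
**the Yang–Mills mass gap (Clay) is NOT proved by any of this.**  [I] = [Balaban1987RG1], [15] = [Balaban1985Variational].
-/

noncomputable section

open scoped BigOperators Matrix.Norms.L2Operator Topology
open Set Filter

namespace Summit.QuantumFields.YangMills.Theorems.PortHRecordJoin

open Summit.QuantumFields.YangMills.Theorems.K0RecordFormatNames
open Summit.QuantumFields.YangMills.Theorems
open Literature.MathematicalPhysics.QuantumFieldTheory.Balaban1983to89
open Literature.MathematicalPhysics.QuantumFieldTheory.Balaban1983to89.Node00
open Literature.MathematicalPhysics.QuantumFieldTheory.Balaban1983to89.T4Continuum (T4Family)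
open Literature.MathematicalPhysics.QuantumFieldTheory.Balaban1983to89.FlowStep
open Literature.MathematicalPhysics.QuantumFieldTheory.Balaban1983to89.T4OutputRate (Window)
open Literature.MathematicalPhysics.QuantumFieldTheory.Balaban1983to89.Node00.U3KernelLetters (PolLimitsExist)

/-! ## §1  The run letters are antitone in the level -/

/-- A run in `]0, γ]` up to `n` is a run in `]0, γ₀]` for `γ ≤ γ₀`. [folklore] -/
theorem inInterval_of_le_radius {γ γ₀ : ℝ} {n : ℕ} {gs : ℕ → ℝ} (h : Step.InInterval γ n gs) (hle : γ ≤ γ₀) : Step.InInterval γ₀ n gs :=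
  fun k hk => ⟨(h k hk).1, (h k hk).2.trans hle⟩

/-- The decay-on-runs letter is ANTITONE in the level: `γ ≤ γ₀` and (5.10) along all `]0, γ₀]`-runs ⟹ (5.10) along all `]0, γ]`-runs, same `(C, δ₁)`.
[cite: Balaban1987RG1, (0.20) p.256, (5.10) p.293 (bookkeeping)] -/
theorem recordPlimDecayOnRunsAx_of_le_radius (F : T4Family) (a₀ ε₂₉ : ℝ) {γ γ₀ C δ₁ : ℝ} (hle : γ ≤ γ₀)
    (h : RecordPlimDecayOnRunsAx F a₀ ε₂₉ γ₀ C δ₁) : RecordPlimDecayOnRunsAx F a₀ ε₂₉ γ C δ₁ :=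
  ⟨h.1, fun n gs hrg hin k hk => h.2 n gs hrg (inInterval_of_le_radius hin hle) k hk⟩

/-- The (1.21)-Ax run letter is ANTITONE in the level. [cite: Balaban1987RG1, (0.20) p.256, (1.21) p.264 (bookkeeping)] -/
theorem recordPolLimitOnRunsAx_of_le_radius (F : T4Family) (a₀ ε₂₉ : ℝ) {γ γ₀ : ℝ} (hle : γ ≤ γ₀)
    (h : RecordPolLimitOnRunsAx F a₀ ε₂₉ γ₀) : RecordPolLimitOnRunsAx F a₀ ε₂₉ γ :=
  fun n gs hrg hin k hk => h n gs hrg (inInterval_of_le_radius hin hle) k hk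

/-- **(A) RESTRICTION OF ⁸'s WHOLE PACKAGE TO A SMALLER LEVEL** (◆ CRIT-1 custody check (A), nodeO STATUS 2026-08-31T04:42:35Z): for ANY run-indexed package `P k g` — here ⁸'s
`FormatPlusG` data (pieces, wrap pieces, (1.18) bounds) with its constants `E₀, κ, α₀, α₁` FIXED (they are ⁸'s `∃`-witnesses, chosen once at ⁸'s own level `γ₀` and used UNCHANGED) —
«`P` along every `]0, γ₀]`-run» ⟹ «`P` along every `]0, γ]`-run» for `γ ≤ γ₀`: ONLY the run-membership guard is level-indexed; no constant degrades with `γ`. [cite: Balaban1987RG1, (0.20) p.256, (1.18)–(1.19) p.263 (bookkeeping)] -/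
theorem alongRuns_of_le_radius {β : HBeta} {γ γ₀ : ℝ} {P : ℕ → (ℕ → ℝ) → Prop}
    (h : ∀ (k : ℕ) (g : ℕ → ℝ), RGEqH k β g → Step.InInterval γ₀ k g → P k g) (hle : γ ≤ γ₀) :
    ∀ (k : ℕ) (g : ℕ → ℝ), RGEqH k β g → Step.InInterval γ k g → P k g :=
  fun k g hrg hin => h k g hrg (inInterval_of_le_radius hin hle)

/-! ## §2  The JOIN's antecedents as ONE displayed Prop; their cofinal supply shape; the RADIUS-UNIFORM goal -/

/-- **`JoinAntecedents Tok F Mc j c c₀ c₁ B₃ B₃' a₀ a₁`** — the CONJUNCTION of ⁸'s twelve antecedents (McGuard; the guards `c ≤ L^j`, `c₀ ≤ j+1`, `c₁ ≤ j`, `2L² ≤ B₃`, `0 < B₃'`,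
`0 < a₀`, `0 < a₁`; [15] Thm 1 `VariationalThm1RegSepCoP7MGB`; Gauge 9 `Gauge9RegSepTopStepGB`; TokUk; TokP9-reg — bytes = the frozen `JoinGoalWith` body's hypotheses VERBATIM) and
the locality token `Tok F Mc a₀`.  A displayed hypothesis SHAPE (Bałaban's theorems AT THE RECORD); nothing asserted.
[cite: Balaban1985Variational, Thm 1 p.279, Prop. 9 p.309; Balaban1987RG1, (1.19) p.263, (2.3) p.265, (4.35) p.290] -/
def JoinAntecedents (Tok : Literature.MathematicalPhysics.QuantumFieldTheory.Balaban1983to89.T4Continuum.T4Family → ℕ → ℝ → Prop)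
    (F : Literature.MathematicalPhysics.QuantumFieldTheory.Balaban1983to89.T4Continuum.T4Family) (Mc j c c₀ c₁ : ℕ) (B₃ B₃' a₀ a₁ : ℝ) : Prop :=
  (Summit.QuantumFields.YangMills.Theorems.K0RecordFormatNames.McGuard F Mc) ∧
  (c ≤ F.L ^ j) ∧
  (c₀ ≤ j + 1) ∧
  (c₁ ≤ j) ∧
  (2 * (F.L : ℝ) ^ 2 ≤ B₃) ∧
  (0 < B₃') ∧
  (0 < a₀) ∧
  (0 < a₁) ∧
  (Literature.MathematicalPhysics.QuantumFieldTheory.Balaban1983to89.Node00.VariationalThm1RegSepCoP7MGB F 2 (fun ν M g K k _s => c ≤ ν.M₁ ∧ k + c₀ ≤ F.m + K ∧ F.L ^ c₁ ∣ M ∧ ∀ i, 1 ≤ i → i ≤ k → Literature.MathematicalPhysics.QuantumFieldTheory.Balaban1983to89.Node00.dCubeSide (F.P K).L M (Literature.MathematicalPhysics.QuantumFieldTheory.Balaban1983to89.Node00.RkOfRecord (F.P K).L ν.r (g i)) i ∣ (F.P K).sitesPerDir 0) (Literature.MathematicalPhysics.QuantumFieldTheory.Balaban1983to89.Node00.lamDatum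 F) (Literature.MathematicalPhysics.QuantumFieldTheory.Balaban1983to89.Node00.dataSmall7LamTopOf F 2) B₃ a₀ a₁) ∧
  (Literature.MathematicalPhysics.QuantumFieldTheory.Balaban1983to89.Node00.Gauge9RegSepTopStepGB F 2 (fun ν K Ω => Literature.MathematicalPhysics.QuantumFieldTheory.Balaban1983to89.Node00.suppDomOfRecord F ν K Ω) (F.L ^ j) (fun ν M g K k _s => c ≤ ν.M₁ ∧ k + c₀ ≤ F.m + K ∧ F.L ^ c₁ ∣ M ∧ ∀ i, 1 ≤ i → i ≤ k → Literature.MathematicalPhysics.QuantumFieldTheory.Balaban1983to89.Node00.dCubeSide (F.P K).L M (Literature.MathematicalPhysics.QuantumFieldTheory.Balaban1983to89.Node00.RkOfRecord (F.P K).L ν.r (g i)) i ∣ (F.P K).sitesPerDir 0) (Literature.MathematicalPhysics.QuantumFieldTheory.Balaban1983to89.Node00.lamDatum F) (Literature.MathematicalPhysics.QuantumFieldTheory.Balaban1983to89.Node00.dataSmall7LamTopOf F 2) B₃ B₃' a₀ a₁) ∧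
  ((∀ ε₁ : ℝ, 0 < ε₁ → ε₁ ≤ a₁ → B₃ * ε₁ ≤ a₀ → ∀ (k n : ℕ) (V : Literature.MathematicalPhysics.QuantumFieldTheory.Balaban1983to89.GaugeField (F.P (Summit.QuantumFields.YangMills.Theorems.K0RecordFormatNames.recordK₀ F Mc k + n)) (k + 1) (Literature.MathematicalPhysics.QuantumFieldTheory.Balaban1983to89.Node00.SU 2)), Literature.MathematicalPhysics.QuantumFieldTheory.Balaban1983to89.PlaqSmall ε₁ V → Literature.MathematicalPhysics.QuantumFieldTheory.Balaban1983to89.Node00.UkExists F 2 (Summit.QuantumFields.YangMills.Theorems.K0RecordFormatNames.recordK₀ F Mc k + n) (k + 1) a₀ V ∧ Literature.MathematicalPhysics.QuantumFieldTheory.Balaban1983to89.Node00.UniqueUkOrbit F 2 (Summit.QuantumFields.YangMills.Theorems.K0RecordFormatNames.recordK₀ F Mc k + n) (k + 1) a₀ V)) ∧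
  ((∀ (k n : ℕ) (ε₂₉ : ℝ), 0 < ε₂₉ → letI θ := Summit.QuantumFields.YangMills.Theorems.K0RecordFormatNames.thetaFill F a₀ ε₂₉; letI := θ.instVβ₁; letI := θ.instVβ₂; letI := θ.instιβ; AnalyticAt ℝ (fun B : Summit.QuantumFields.YangMills.Theorems.K0RecordFormatNames.recordW F a₀ ε₂₉ k (Summit.QuantumFields.YangMills.Theorems.K0RecordFormatNames.recordK₀ F Mc k + n) => fun (b : Literature.MathematicalPhysics.QuantumFieldTheory.Balaban1983to89.PBond (F.P (Summit.QuantumFields.YangMills.Theorems.K0RecordFormatNames.recordK₀ F Mc k + n)) 0) (i i' : Fin 2) => ((Summit.QuantumFields.YangMills.Theorems.K0RecordFormatNames.recordBgField F θ k (Summit.QuantumFields.YangMills.Theorems.K0RecordFormatNames.recordK₀ F Mc k + n) B b : Literature.MathematicalPhysics.QuantumFieldTheory.Balaban1983to89.Node00.SU 2) : Matrix (Fin 2) (Fin 2) ℂ) i i') 0)) ∧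
  Tok F Mc a₀

/-- **`JoinAntecedentsCofinal Tok F`** — the SUPPLY SHAPE: for every threshold `Mth` and every radius `a₀ > 0`, the thirteen antecedents hold at some `Mc ≥ Mth` (with some
`j c c₀ c₁ B₃ B₃' a₁`).  This is what [I] §1 ∕ [15] Thm 1 + Prop. 9 AT THE RECORD would deliver («for M large enough»); displayed, inhabited nowhere in the tree.
[cite: Balaban1987RG1, Thm 1 p.259, (1.19) p.263; Balaban1985Variational, Thm 1 p.279, Prop. 9 p.309] -/
def JoinAntecedentsCofinal (Tok : Literature.MathematicalPhysics.QuantumFieldTheory.Balaban1983to89.T4Continuum.T4Family → ℕ → ℝ → Prop) (F : Literature.MathematicalPhysics.QuantumFieldTheory.Balaban1983to89.T4Continuum.T4Family) : Prop :=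
  ∀ (Mth : ℕ) (a₀ : ℝ), 0 < a₀ → ∃ Mc : ℕ, Mth ≤ Mc ∧ ∃ (j c c₀ c₁ : ℕ) (B₃ B₃' a₁ : ℝ), JoinAntecedents Tok F Mc j c c₀ c₁ B₃ B₃' a₀ a₁

/-- **`JoinGoalWithR Tok F` — THE RADIUS-UNIFORM JOIN GOAL** (a THEOREM-SIDE companion of the frozen `JoinGoalWith Tok F`, ◆ CRIT-1 04:42:35Z «welcome as theorems beside the frozen
goal; do NOT re-point `JoinGoalL ∕ JoinGoalL11G4`»): the same 13 hypotheses VERBATIM, consequent `∃ γ₀ ε₂₉ C δ₁, 0 < γ₀ ∧ 0 < ε₂₉ ∧ ∀ γ ≤ γ₀, (RecordPolLimitOnRunsAx F a₀ ε₂₉ γ →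
RecordPlimDecayOnRunsAx F a₀ ε₂₉ γ C δ₁)` — ONE `ε₂₉` SHARED by limit and decay (check (B)), `γ` touching the level only.  A SHAPE; nothing asserted.
[cite: Balaban1987RG1, Thm 1 p.259, (0.20) p.256, (1.19)–(1.22) pp.263–264, (5.10) p.293; Balaban1985Variational, Prop. 9 p.309] -/
def JoinGoalWithR (Tok : Literature.MathematicalPhysics.QuantumFieldTheory.Balaban1983to89.T4Continuum.T4Family → ℕ → ℝ → Prop) (F : Literature.MathematicalPhysics.QuantumFieldTheory.Balaban1983to89.T4Continuum.T4Family) : Prop :=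
  ∃ Mth : ℕ, ∀ Mc : ℕ, Mth ≤ Mc → ∀ (j c c₀ c₁ : ℕ) (B₃ B₃' a₀ a₁ : ℝ), Summit.QuantumFields.YangMills.Theorems.K0RecordFormatNames.McGuard F Mc → c ≤ F.L ^ j → c₀ ≤ j + 1 → c₁ ≤ j → 2 * (F.L : ℝ) ^ 2 ≤ B₃ → 0 < B₃' → 0 < a₀ → 0 < a₁ → Literature.MathematicalPhysics.QuantumFieldTheory.Balaban1983to89.Node00.VariationalThm1RegSepCoP7MGB F 2 (fun ν M g K k _s => c ≤ ν.M₁ ∧ k + c₀ ≤ F.m + K ∧ F.L ^ c₁ ∣ M ∧ ∀ i, 1 ≤ i → i ≤ k → Literature.MathematicalPhysics.QuantumFieldTheory.Balaban1983to89.Node00.dCubeSide (F.P K).L M (Literature.MathematicalPhysics.QuantumFieldTheory.Balaban1983to89.Node00.RkOfRecord (F.P K).L ν.r (g i)) i ∣ (F.P K).sitesPerDir 0) (Literature.MathematicalPhysics.QuantumFieldTheory.Balaban1983to89.Node00.lamDatum F) (Literature.MathematicalPhysics.QuantumFieldTheory.Balaban1983to89.Node00.dataSmall7LamTopOf F 2)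 B₃ a₀ a₁ → Literature.MathematicalPhysics.QuantumFieldTheory.Balaban1983to89.Node00.Gauge9RegSepTopStepGB F 2 (fun ν K Ω => Literature.MathematicalPhysics.QuantumFieldTheory.Balaban1983to89.Node00.suppDomOfRecord F ν K Ω) (F.L ^ j) (fun ν M g K k _s => c ≤ ν.M₁ ∧ k + c₀ ≤ F.m + K ∧ F.L ^ c₁ ∣ M ∧ ∀ i, 1 ≤ i → i ≤ k → Literature.MathematicalPhysics.QuantumFieldTheory.Balaban1983to89.Node00.dCubeSide (F.P K).L M (Literature.MathematicalPhysics.QuantumFieldTheory.Balaban1983to89.Node00.RkOfRecord (F.P K).L ν.r (g i)) i ∣ (F.P K).sitesPerDir 0) (Literature.MathematicalPhysics.QuantumFieldTheory.Balaban1983to89.Node00.lamDatum F) (Literature.MathematicalPhysics.QuantumFieldTheory.Balaban1983to89.Node00.dataSmall7LamTopOf F 2) B₃ B₃' a₀ a₁ → (∀ ε₁ : ℝ, 0 < ε₁ → ε₁ ≤ a₁ → B₃ * ε₁ ≤ a₀ → ∀ (k n : ℕ) (V : Literature.MathematicalPhysics.QuantumFieldTheory.Balaban1983to89.GaugeField (F.P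 (Summit.QuantumFields.YangMills.Theorems.K0RecordFormatNames.recordK₀ F Mc k + n)) (k + 1) (Literature.MathematicalPhysics.QuantumFieldTheory.Balaban1983to89.Node00.SU 2)), Literature.MathematicalPhysics.QuantumFieldTheory.Balaban1983to89.PlaqSmall ε₁ V → Literature.MathematicalPhysics.QuantumFieldTheory.Balaban1983to89.Node00.UkExists F 2 (Summit.QuantumFields.YangMills.Theorems.K0RecordFormatNames.recordK₀ F Mc k + n) (k + 1) a₀ V ∧ Literature.MathematicalPhysics.QuantumFieldTheory.Balaban1983to89.Node00.UniqueUkOrbit F 2 (Summit.QuantumFields.YangMills.Theorems.K0RecordFormatNames.recordK₀ F Mc k + n) (k + 1) a₀ V) → (∀ (k n : ℕ) (ε₂₉ : ℝ), 0 < ε₂₉ → letI θ := Summit.QuantumFields.YangMills.Theorems.K0RecordFormatNames.thetaFill F a₀ ε₂₉; letI := θ.instVβ₁; letI := θ.instVβ₂; letI := θ.instιβ; AnalyticAt ℝ (fun B : Summit.QuantumFields.YangMills.Theorems.K0RecordFormatNames.recordW F a₀ ε₂₉ k (Summit.QuantumFields.YangMills.Theorems.K0RecordFormatNames.recordK₀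 F Mc k + n) => fun (b : Literature.MathematicalPhysics.QuantumFieldTheory.Balaban1983to89.PBond (F.P (Summit.QuantumFields.YangMills.Theorems.K0RecordFormatNames.recordK₀ F Mc k + n)) 0) (i i' : Fin 2) => ((Summit.QuantumFields.YangMills.Theorems.K0RecordFormatNames.recordBgField F θ k (Summit.QuantumFields.YangMills.Theorems.K0RecordFormatNames.recordK₀ F Mc k + n) B b : Literature.MathematicalPhysics.QuantumFieldTheory.Balaban1983to89.Node00.SU 2) : Matrix (Fin 2) (Fin 2) ℂ) i i') 0) → Tok F Mc a₀ → ∃ γ₀ ε₂₉ C δ₁ : ℝ, 0 < γ₀ ∧ 0 < ε₂₉ ∧ ∀ γ : ℝ, γ ≤ γ₀ → (Summit.QuantumFields.YangMills.Theorems.K0RecordFormatNames.RecordPolLimitOnRunsAx F a₀ ε₂₉ γ → Summit.QuantumFields.YangMills.Theorems.K0RecordFormatNames.RecordPlimDecayOnRunsAx F a₀ ε₂₉ γ C δ₁)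

/-- The radius-uniform goal implies the frozen one (`γ := γ₀`, `le_rfl`). [cite: Balaban1987RG1, (4.35) p.290 (bookkeeping)] -/
theorem joinGoalWith_of_joinGoalWithR {Tok : T4Family → ℕ → ℝ → Prop} {F : T4Family} (h : JoinGoalWithR Tok F) : JoinGoalWith Tok F := by
  unfold JoinGoalWithR at h
  unfold JoinGoalWith
  obtain ⟨Mth, h⟩ := h
  refine ⟨Mth, fun Mc hMc j c c₀ c₁ B₃ B₃' a₀ a₁ hG0 hc hc₀ hc₁ hB₃ hB₃' ha₀ ha₁ hThm hGauge hUk hBg hTok => ?_⟩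
  obtain ⟨γ₀, ε₂₉, C, δ₁, hγ₀, hε, himp⟩ := h Mc hMc j c c₀ c₁ B₃ B₃' a₀ a₁ hG0 hc hc₀ hc₁ hB₃ hB₃' ha₀ ha₁ hThm hGauge hUk hBg hTok
  exact ⟨γ₀, ε₂₉, C, δ₁, hγ₀, hε, himp γ₀ le_rfl⟩

/-- RECEIPT: the frozen goal, read with the antecedents bundled (kernel: uncurrying only). [cite: Balaban1987RG1, (4.35) p.290 (bookkeeping)] -/
theorem joinGoalWith_apply {Tok : T4Family → ℕ → ℝ → Prop} {F : T4Family} (hJ : JoinGoalWith Tok F) :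
    ∃ Mth : ℕ, ∀ Mc : ℕ, Mth ≤ Mc → ∀ (j c c₀ c₁ : ℕ) (B₃ B₃' a₀ a₁ : ℝ), JoinAntecedents Tok F Mc j c c₀ c₁ B₃ B₃' a₀ a₁ →
      ∃ γ₀ ε₂₉ C δ₁ : ℝ, 0 < γ₀ ∧ 0 < ε₂₉ ∧ (Summit.QuantumFields.YangMills.Theorems.K0RecordFormatNames.RecordPolLimitOnRunsAx F a₀ ε₂₉ γ₀ → Summit.QuantumFields.YangMills.Theorems.K0RecordFormatNames.RecordPlimDecayOnRunsAx F a₀ ε₂₉ γ₀ C δ₁) := by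
  unfold JoinGoalWith at hJ
  obtain ⟨Mth, h⟩ := hJ
  refine ⟨Mth, fun Mc hMc j c c₀ c₁ B₃ B₃' a₀ a₁ hA => ?_⟩
  obtain ⟨hG0, hc, hc₀, hc₁, hB₃, hB₃', ha₀, ha₁, hThm, hGauge, hUk, hBg, hTok⟩ := hA
  exact h Mc hMc j c c₀ c₁ B₃ B₃' a₀ a₁ hG0 hc hc₀ hc₁ hB₃ hB₃' ha₀ ha₁ hThm hGauge hUk hBg hTok

/-! ## §3  The RADIUS-UNIFORM JOIN (same proof as `joinGoalWith_of_texts`, consequent uniform in the level `γ ≤ γ₀`) -/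

/-- ★ **THE RADIUS-UNIFORM JOIN, FOR EVERY TOKEN, PER FAMILY**: ⁸ at `F` ∧ any ⁷-shaped text at `F` whose token implies `TokP9L4Old` ⟹ for `Mc ≥ Mth`, under the bundled antecedents,
`∃ γ₀ ε₂₉ C δ₁, 0 < γ₀ ∧ 0 < ε₂₉ ∧ ∀ γ ≤ γ₀, (RecordPolLimitOnRunsAx F a₀ ε₂₉ γ → RecordPlimDecayOnRunsAx F a₀ ε₂₉ γ C δ₁)` — the JOIN read run-by-run: ⁸'s `FormatPlusG` along
`]0, γ₀]`-runs restricts to `]0, γ]`-runs (`inInterval_of_le_radius`), and the tree's run level ✓`recordPlimDecayOnRunsAx_at_recordEmbL_of_trace` is applied AT `γ` with the SAME letters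
(`α₂`, `C₉`, `δ₀`, `Mg := 4Mc+1`, `C := 16·E₀·C₉²·e^{δ₁ Mg c₁}·K₀·K₁`, `δ₁ := delta1 δ₀ κ Mg`).  Receipts BY NAME as in `joinGoalWith_of_texts`.  CONDITIONAL; nothing of [I]∕[15] discharged.
[cite: Balaban1987RG1, Thm 1 p.259, (0.20) p.256, (1.19)–(1.22) pp.263–264, (4.35)–(4.37) p.290, (5.10) p.293; Balaban1985Variational, Prop. 9 p.309, (190) p.308, (21) p.281] -/
theorem decayConclR_of_texts (Tok : T4Family → ℕ → ℝ → Prop)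
    (hBr : ∀ (F : T4Family) (Mc : ℕ) (a₀ : ℝ), Tok F Mc a₀ → TokP9L4Old F Mc a₀)
    (F : T4Family) (h8 : Sig8LR4 F) (h7 : Sig7With Tok F) :
    ∃ Mth : ℕ, ∀ Mc : ℕ, Mth ≤ Mc → ∀ (j c c₀ c₁ : ℕ) (B₃ B₃' a₀ a₁ : ℝ), JoinAntecedents Tok F Mc j c c₀ c₁ B₃ B₃' a₀ a₁ →
      ∃ γ₀ ε₂₉ C δ₁ : ℝ, 0 < γ₀ ∧ 0 < ε₂₉ ∧ ∀ γ : ℝ, γ ≤ γ₀ →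
        (RecordPolLimitOnRunsAx F a₀ ε₂₉ γ → RecordPlimDecayOnRunsAx F a₀ ε₂₉ γ C δ₁) := by
  unfold Sig8LR4 at h8
  obtain ⟨Mth, h8F⟩ := h8
  refine ⟨Mth, ?_⟩
  intro Mc hMc j c c₀ c₁ B₃ B₃' a₀ a₁ hA
  obtain ⟨hG0, hc, hc₀, hc₁, hB₃, hB₃', ha₀, ha₁, hThm, hGauge, hUk, hBg, hP9⟩ := hA
  have hP9old : TokP9L4Old F Mc a₀ := hBr F Mc a₀ hP9
  obtain ⟨γ₀, ε₂₉, E₀, κ, α₀, α₁, hγ₀, hε, hE₀, hκ4, hα₀, hα₁, hFmt⟩ :=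
    h8F Mc hMc j c c₀ c₁ B₃ B₃' a₀ a₁ hG0 hc hc₀ hc₁ hB₃ hB₃' ha₀ ha₁ hThm hGauge hUk hBg hP9old
  have hα₂ : 0 < min (1 / 4 : ℝ) (min α₁ (α₀ / 36)) := lt_min (by norm_num) (lt_min hα₁ (by positivity))
  obtain ⟨C₉, δ₀, hC₉, hδ₀, h7k⟩ :=
    h7 Mc j c c₀ c₁ B₃ B₃' a₀ a₁ hG0 hc hc₀ hc₁ hB₃ hB₃' ha₀ ha₁ hThm hGauge hUk hBg hP9 _ hα₂
  have hκ : 0 < κ := by linarith [kappa₀_std_pos]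
  have hκ2 : 2 * B12TreeDecay.kappa₀ (4 * 2 ^ 4) (2 * 4) ≤ κ := by linarith [kappa₀_std_pos]
  have hMg : 0 < 4 * (Mc : ℝ) + 1 := by positivity
  have hMg4 : 4 * (Mc : ℝ) ≤ 4 * (Mc : ℝ) + 1 := by linarith
  refine ⟨γ₀, ε₂₉, 16 * E₀ * C₉ ^ 2 * Real.exp (B12Decay510.delta1 δ₀ κ (4 * (Mc : ℝ) + 1) * (4 * (Mc : ℝ) + 1) * 2) *
      B12TreeDecay.K₀ (4 * 2 ^ 4) (2 * 4) * (2 * (1 - Real.exp (-(δ₀ / 2)))⁻¹) ^ 4,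
    B12Decay510.delta1 δ₀ κ (4 * (Mc : ℝ) + 1), hγ₀, hε, fun γ hγ h121 => ?_⟩
  exact recordPlimDecayOnRunsAx_at_recordEmbL_of_trace (E₀ := E₀) (κ := κ) (C₉ := C₉) (δ₀ := δ₀) (Mg := 4 * (Mc : ℝ) + 1) (c₁ := 2)
    (K₀' := B12TreeDecay.K₀ (4 * 2 ^ 4) (2 * 4)) (K₁ := (2 * (1 - Real.exp (-(δ₀ / 2)))⁻¹) ^ 4) hE₀ hκ hC₉ hδ₀ hMg (B12TreeDecay.K₀_pos _ _).le
    F a₀ ε₂₉ γ α₀ α₁ hα₀ hα₁ Mc (alongRuns_of_le_radius hFmt hγ) (fun k n => hBg k n ε₂₉ hε)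
    (fun k => ⟨h7k k ε₂₉ hε,
      fun n => iotaRowAtL_of_p9RegAt F a₀ ε₂₉ ha₀ k _ (BalabanUVNodesPortS1.succ_le_m_add_K_recordK₀ F Mc k n) (hBg k n ε₂₉ hε),
      fun n a => responseRowAtL_of_p9RegAt F a₀ ε₂₉ ha₀ k _ (BalabanUVNodesPortS1.succ_le_m_add_K_recordK₀ F Mc k n) (hBg k n ε₂₉ hε) a⟩)
    (fun k => PortHRecordRowG.rowG_slot8_at_names (F := F) (k := k) hG0 hMg4 hκ2 hδ₀) h121

/-- ★ **THE RADIUS-UNIFORM JOIN in the frozen goal's CURRIED arity**: `Sig8LR4 F → Sig7With Tok F → JoinGoalWithR Tok F` (so `joinGoalWith_of_texts = joinGoalWith_of_joinGoalWithR ∘ this`).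
[cite: Balaban1987RG1, Thm 1 p.259, (1.19)–(1.22) pp.263–264, (5.10) p.293; Balaban1985Variational, Prop. 9 p.309] -/
theorem joinGoalWithR_of_texts (Tok : T4Family → ℕ → ℝ → Prop)
    (hBr : ∀ (F : T4Family) (Mc : ℕ) (a₀ : ℝ), Tok F Mc a₀ → TokP9L4Old F Mc a₀)
    (F : T4Family) (h8 : Sig8LR4 F) (h7 : Sig7With Tok F) : JoinGoalWithR Tok F := by
  obtain ⟨Mth, h⟩ := decayConclR_of_texts Tok hBr F h8 h7
  unfold JoinGoalWithR
  exact ⟨Mth, fun Mc hMc j c c₀ c₁ B₃ B₃' a₀ a₁ hG0 hc hc₀ hc₁ hB₃ hB₃' ha₀ ha₁ hThm hGauge hUk hBg hTok =>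
    h Mc hMc j c c₀ c₁ B₃ B₃' a₀ a₁ ⟨hG0, hc, hc₀, hc₁, hB₃, hB₃', ha₀, ha₁, hThm, hGauge, hUk, hBg, hTok⟩⟩

/-! ## §4  The decay letter of the doors (T′ per family) -/

/-- ★★ **THE DECAY LETTER OF THE DOORS at `F`** (lens-1's T′ per family; `γ₀ ≤ ½`): the two texts at `F` + the antecedents supplied COFINALLY in `Mc` at every radius + the (1.21)-Ax
run letter on levels `≤ ½` ⟹ `∀ a₀ > 0, ∃ γ₀ ε₂₉ C δ₁, 0 < γ₀ ∧ γ₀ ≤ ½ ∧ 0 < ε₂₉ ∧ RecordPlimDecayOnRunsAx F a₀ ε₂₉ γ₀ C δ₁` (level := `min γ₀ ½` of ⁸'s `γ₀`).  CONDITIONAL.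
[cite: Balaban1987RG1, Thm 1 p.259, Thm 3 p.264, (1.21)–(1.22) p.264, (5.10) p.293; Balaban1985Variational, Prop. 9 p.309] -/
theorem decayLetter_of_texts (Tok : T4Family → ℕ → ℝ → Prop)
    (hBr : ∀ (F : T4Family) (Mc : ℕ) (a₀ : ℝ), Tok F Mc a₀ → TokP9L4Old F Mc a₀)
    (F : T4Family) (h8 : Sig8LR4 F) (h7 : Sig7With Tok F) (hA : JoinAntecedentsCofinal Tok F)
    (h121 : ∀ (a₀ ε₂₉ γ : ℝ), 0 < a₀ → 0 < ε₂₉ → 0 < γ → γ ≤ 1 / 2 → RecordPolLimitOnRunsAx F a₀ ε₂₉ γ) :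
    ∀ a₀ : ℝ, 0 < a₀ → ∃ γ₀ ε₂₉ C δ₁ : ℝ, 0 < γ₀ ∧ γ₀ ≤ 1 / 2 ∧ 0 < ε₂₉ ∧ RecordPlimDecayOnRunsAx F a₀ ε₂₉ γ₀ C δ₁ := by
  obtain ⟨Mth, hJ⟩ := decayConclR_of_texts Tok hBr F h8 h7
  intro a₀ ha₀
  obtain ⟨Mc, hMc, j, c, c₀, c₁, B₃, B₃', a₁, hAnt⟩ := hA Mth a₀ ha₀
  obtain ⟨γ₀, ε₂₉, C, δ₁, hγ₀, hε, himp⟩ := hJ Mc hMc j c c₀ c₁ B₃ B₃' a₀ a₁ hAnt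
  have hγ : 0 < min γ₀ (1 / 2 : ℝ) := lt_min hγ₀ (by norm_num)
  exact ⟨min γ₀ (1 / 2), ε₂₉, C, δ₁, hγ, min_le_right _ _, hε,
    himp _ (min_le_left _ _) (h121 a₀ ε₂₉ _ ha₀ hε hγ (min_le_right _ _))⟩

/-- The (1.21)-Ax run letter on levels `≤ ½` from its WINDOW-`½` form (DEF-1 Lemmas6 ✓`recordPolLimitOnRunsAx_of_polLimitsExist`). [cite: Balaban1987RG1, (1.21) p.264, (0.20) p.256 (bookkeeping)] -/
theorem run121_of_window121 (F : T4Family)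
    (hW : ∀ (a₀ ε₂₉ : ℝ), 0 < a₀ → 0 < ε₂₉ →
      letI θ := thetaFill F a₀ ε₂₉
      letI := θ.instVβ₁; letI := θ.instVβ₂; letI := θ.instιβ
      PolLimitsExist F (recordTermsAx F a₀ ε₂₉) θ.ρ8 θ.bV (Window (1 / 2))) :
    ∀ (a₀ ε₂₉ γ : ℝ), 0 < a₀ → 0 < ε₂₉ → 0 < γ → γ ≤ 1 / 2 → RecordPolLimitOnRunsAx F a₀ ε₂₉ γ :=
  fun a₀ ε₂₉ _γ ha₀ hε _ hγh => recordPolLimitOnRunsAx_of_polLimitsExist F a₀ ε₂₉ hγh (hW a₀ ε₂₉ ha₀ hε)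

/-! ## §5  (appended 2026-08-31, ◇ lens-1 g6 SCOPE FLAG ∕ docket O-11, nodeO STATUS 04:43:19Z) The `h121`-FREE sibling: the (1.21) proviso DISCHARGED IN SCOPE.
`decayLetter_of_texts` above takes the (1.21)-Ax run letter for EVERY `ε₂₉ > 0` and every level `≤ ½` — OUTSIDE ⁸'s `∃ γ₀ ε₂₉` scope, feedable only by the K3-side window supplier.
The LIMIT twin of docket O-11 (lens-1's two-volume Cauchy kit, `joinConclLimR_of_texts`-to-be) produces (1.21) only IN SCOPE — at the JOIN's own witness `(γ₀, ε₂₉)`, from ⁸'s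
package.  The two declarations below are the consumer-side slot for it: the radius-uniform consequent with the proviso DISCHARGED, and the door lemma that needs NO `h121`. -/

/-- **`JoinConclLimR Tok F` — the radius-uniform JOIN consequent with the (1.21) proviso DISCHARGED IN SCOPE** (◇ lens-1 g6, docket O-11): for `Mc ≥ Mth`, under the bundled antecedents,
`∃ γ₀ ε₂₉ C δ₁, 0 < γ₀ ∧ 0 < ε₂₉ ∧ ∀ γ ≤ γ₀, (RecordPolLimitOnRunsAx F a₀ ε₂₉ γ ∧ RecordPlimDecayOnRunsAx F a₀ ε₂₉ γ C δ₁)` — BOTH the (1.21) limit and the (5.10) decay along every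
`]0, γ]`-run, ONE shared `ε₂₉`.  A SHAPE to be supplied by O-11's limit twin (`joinConclLimR_of_texts : Sig8LR4 F → Sig7With Tok F → JoinConclLimR Tok F`, NOT in this file); nothing asserted here.
[cite: Balaban1987RG1, Thm 1 p.259, (1.21)–(1.22) p.264, (4.37) p.291, (5.10) p.293] -/
def JoinConclLimR (Tok : Literature.MathematicalPhysics.QuantumFieldTheory.Balaban1983to89.T4Continuum.T4Family → ℕ → ℝ → Prop) (F : Literature.MathematicalPhysics.QuantumFieldTheory.Balaban1983to89.T4Continuum.T4Family) : Prop :=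
  ∃ Mth : ℕ, ∀ Mc : ℕ, Mth ≤ Mc → ∀ (j c c₀ c₁ : ℕ) (B₃ B₃' a₀ a₁ : ℝ), JoinAntecedents Tok F Mc j c c₀ c₁ B₃ B₃' a₀ a₁ →
    ∃ γ₀ ε₂₉ C δ₁ : ℝ, 0 < γ₀ ∧ 0 < ε₂₉ ∧ ∀ γ : ℝ, γ ≤ γ₀ →
      (Summit.QuantumFields.YangMills.Theorems.K0RecordFormatNames.RecordPolLimitOnRunsAx F a₀ ε₂₉ γ ∧
        Summit.QuantumFields.YangMills.Theorems.K0RecordFormatNames.RecordPlimDecayOnRunsAx F a₀ ε₂₉ γ C δ₁)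

/-- `JoinConclLimR` from the radius-uniform JOIN consequent PLUS an in-scope limit supplier (the shape O-11 will prove from ⁸'s package; recorded so the two roads compose by name).
[cite: Balaban1987RG1, (1.21) p.264, (5.10) p.293 (bookkeeping)] -/
theorem joinConclLimR_of_decayConclR {Tok : T4Family → ℕ → ℝ → Prop} {F : T4Family}
    (hD : ∃ Mth : ℕ, ∀ Mc : ℕ, Mth ≤ Mc → ∀ (j c c₀ c₁ : ℕ) (B₃ B₃' a₀ a₁ : ℝ), JoinAntecedents Tok F Mc j c c₀ c₁ B₃ B₃' a₀ a₁ →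
      ∃ γ₀ ε₂₉ C δ₁ : ℝ, 0 < γ₀ ∧ 0 < ε₂₉ ∧ (∀ γ : ℝ, γ ≤ γ₀ → RecordPolLimitOnRunsAx F a₀ ε₂₉ γ) ∧
        ∀ γ : ℝ, γ ≤ γ₀ → (RecordPolLimitOnRunsAx F a₀ ε₂₉ γ → RecordPlimDecayOnRunsAx F a₀ ε₂₉ γ C δ₁)) :
    JoinConclLimR Tok F := by
  obtain ⟨Mth, h⟩ := hD
  refine ⟨Mth, fun Mc hMc j c c₀ c₁ B₃ B₃' a₀ a₁ hA => ?_⟩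
  obtain ⟨γ₀, ε₂₉, C, δ₁, hγ₀, hε, hlim, himp⟩ := h Mc hMc j c c₀ c₁ B₃ B₃' a₀ a₁ hA
  exact ⟨γ₀, ε₂₉, C, δ₁, hγ₀, hε, fun γ hγ => ⟨hlim γ hγ, himp γ hγ (hlim γ hγ)⟩⟩

/-- ★★ **THE DECAY LETTER OF THE DOORS WITHOUT `h121`** (◇ lens-1 g6's requested sibling): the antecedents supplied cofinally + `JoinConclLimR Tok F` ⟹ `∀ a₀ > 0, ∃ γ₀ ε₂₉ C δ₁,
0 < γ₀ ∧ γ₀ ≤ ½ ∧ 0 < ε₂₉ ∧ RecordPlimDecayOnRunsAx F a₀ ε₂₉ γ₀ C δ₁` (level `min γ₀ ½`; the (1.21) limit never leaves the JOIN's own scope).  CONDITIONAL on the two displayed shapes.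
[cite: Balaban1987RG1, Thm 1 p.259, Thm 3 p.264, (1.21)–(1.22) p.264, (5.10) p.293] -/
theorem decayLetter_of_lim {Tok : T4Family → ℕ → ℝ → Prop} {F : T4Family}
    (hA : JoinAntecedentsCofinal Tok F) (hL : JoinConclLimR Tok F) :
    ∀ a₀ : ℝ, 0 < a₀ → ∃ γ₀ ε₂₉ C δ₁ : ℝ, 0 < γ₀ ∧ γ₀ ≤ 1 / 2 ∧ 0 < ε₂₉ ∧ RecordPlimDecayOnRunsAx F a₀ ε₂₉ γ₀ C δ₁ := by
  obtain ⟨Mth, hJ⟩ := hL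
  intro a₀ ha₀
  obtain ⟨Mc, hMc, j, c, c₀, c₁, B₃, B₃', a₁, hAnt⟩ := hA Mth a₀ ha₀
  obtain ⟨γ₀, ε₂₉, C, δ₁, hγ₀, hε, hboth⟩ := hJ Mc hMc j c c₀ c₁ B₃ B₃' a₀ a₁ hAnt
  exact ⟨min γ₀ (1 / 2), ε₂₉, C, δ₁, lt_min hγ₀ (by norm_num), min_le_right _ _, hε, (hboth _ (min_le_left _ _)).2⟩

/-! ## §6  (appended 2026-08-31; ★ P3 g88's §1 of `nodeO-cover/P3-K0AxJoinResidual-v1.lean` 0979a84191728227, MOVED HERE VERBATIM so that the definition stays outside the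
route file's import cone — gate lint `theses-cone`; author ★ P3 g88) The supply shape on COFINALLY SMALL radii -/

/-- **`JoinAntecedentsCofinalRadii Tok F`** — ▶ PTC-1's `JoinAntecedentsCofinal Tok F` with «every radius `a₀ > 0`» weakened to «some radius `a₀ ∈ ]0, a]` below every
ceiling `a`»: for every threshold `Mth` and ceiling `a > 0` the JOIN's thirteen antecedents hold at some `a₀ ≤ a`, some `Mc ≥ Mth` (with some `j c c₀ c₁ B₃ B₃' a₁`).
A displayed SHAPE; §3 inhabits it from three residual tokens. [cite: Balaban1987RG1, Thm 1 p.259, Thm 3 p.264, (1.19) p.263; Balaban1985Variational, Thm 1 p.279, Prop. 9 p.309] -/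
def JoinAntecedentsCofinalRadii (Tok : Literature.MathematicalPhysics.QuantumFieldTheory.Balaban1983to89.T4Continuum.T4Family → ℕ → ℝ → Prop)
    (F : Literature.MathematicalPhysics.QuantumFieldTheory.Balaban1983to89.T4Continuum.T4Family) : Prop :=
  ∀ (Mth : ℕ) (a : ℝ), 0 < a → ∃ a₀ : ℝ, 0 < a₀ ∧ a₀ ≤ a ∧ ∃ Mc : ℕ, Mth ≤ Mc ∧
    ∃ (j c c₀ c₁ : ℕ) (B₃ B₃' a₁ : ℝ), JoinAntecedents Tok F Mc j c c₀ c₁ B₃ B₃' a₀ a₁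

/-- All radii ⟹ cofinal radii (`a₀ := a`). [cite: Balaban1987RG1, Thm 3 p.264 (bookkeeping)] -/
theorem joinAntecedentsCofinalRadii_of_cofinal {Tok : T4Family → ℕ → ℝ → Prop} {F : T4Family} (h : JoinAntecedentsCofinal Tok F) :
    JoinAntecedentsCofinalRadii Tok F := by
  intro Mth a ha
  obtain ⟨Mc, hMc, j, c, c₀, c₁, B₃, B₃', a₁, hA⟩ := h Mth a ha
  exact ⟨a, ha, le_rfl, Mc, hMc, j, c, c₀, c₁, B₃, B₃', a₁, hA⟩

end Summit.QuantumFields.YangMills.Theorems.PortHRecordJoin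

end
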